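import Summits.QuantumAdvantage.QuantumAdvantage.Theorems.CubicForrelationNearExactIsExactTwelveLevelFiveRigidPartner

/-!
# Crux `CubicForrelation.NearExactIsExact` (stmt-QuantumAdvantage-14043) — n = 12, open window `(57/64, 29/32)`: the RIGID level-5 side with
  `4 ∣ e₅` off the odd hyperplane is IMPOSSIBLE (the type-O partner is excluded too)

Certificate seat `b2b-cforr-cert` (gen 29).  HONEST FRAMING: kernel-checked finite-slice theorem (standard axioms) about cubic Boolean pairs on
12 bits.  With …TwelveLevelFiveRigidPartner (level-5 / level-`≥ 6` partners impossible) this closes the rigid branch of `tzl5_window_structure`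
under `4 ∣ e₅` off `P`: on the open window a level-5 side `g` (`W_g = 32u'`, some `u'` odd) has a point OFF its odd hyperplane with
`4 ∤ e₅` (case α, whose 8-flat structure is …TwelveLevelFiveAlphaFlat).  NO value of `θ₁₂` is claimed (`θ₁₂ ∈ [57/64, 14847/16384]`
unchanged); NOT summit progress.

THE ARGUMENT (type-O partner `W_f = 16u_f`, all `u_f` odd, `#E_f ≥ 512` where `E_f = {u_f ≡ ±1 (8)}`, `tzp_typeO_struct`).
1. (…RigidSign `tzv_SR_count`) the coset character sum `S_R(y) ∈ {0,128}` is non-zero on exactly `32` frequencies, and where it vanishes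
   so do `M` and `T`, i.e. `Ŝ' = 0`.
2. (…RigidPartner `tzv_q_lower`) `W(e₅ − S')(y) = 128(−1)^g − 32u_f − Ŝ'(y)` has square `≥ 32²` everywhere (`Ŝ' ∈ 512ℤ`) and `≥ 96²` on
   `E_f ∖ supp S_R`; Parseval gives `Σ_x (e₅ − S')² ≥ 1024 + 2·(512 − 32) = 1984`.
3. `tzv_not_typeO_partner` (this file): against the budget (`3·Q_A ≤ 4·C_A`, `Q_L ≤ 4·C_L`, `64 ∣ Q_A, Q_L`, `16 ∣ E_off`, `C_A + C_L + E_off ≤ 511`)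
   this forces `E_off = 0`, `e₅ = σ₅` on `P ∖ L₅`, `Q_L = Σ_{L₅}(e₅ + 3σ₅)² = 1984`, `C_L ≥ 496`, whence `Σ_{L₅} σ₅e₅ = −136` (`≡ 0 mod 8`).
   At a frequency `y*` with `S_R(y*) = 128` every character value `(−1)^{x·y*}` on `L₅ = t ⊕ R` equals `κσ₅(x)` (`κ = ±1`), so
   `W(e₅ − S')(y*) = κ·Σ_{L₅}(σ₅e₅ + 3) = 248κ`, while it also equals `128(−1)^g − 32u_f(y*) − 512k ∈ 32ℤ` — contradiction.
4. `tzv_rigid_window_false`, `tzv_levelFive_window_alpha`: packaging on the window (with gen 27's `tzl5_window_structure`).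

References: MacWilliams–Sloane (1977) Ch. 14–15; R. O'Donnell (2014) §1.4; C. Carlet (2021) §5.2.  Axioms: the standard three.
-/

set_option linter.dupNamespace false -- D-0017: single-problem summit ⇒ `QuantumAdvantage.QuantumAdvantage` by design

noncomputable section

namespace Summit.QuantumAdvantage.QuantumAdvantage.Theorems.CubicForrelation.NearExactIsExact

open Finset
open Literature.Computability.QuantumComplexity
open Literature.Computability.QuantumComplexity.BuzetChailloux (bxor zeroVec bxor_bxor_cancel_left bxor_zeroVec zeroVec_bxor bxor_comm
  bxor_self)
open Literature.Computability.QuantumComplexity.DerivativeWalsh (W sum_W_sq twist_bxor_left)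
open Literature.Computability.QuantumComplexity.Simon (twist_eq_one_or twist_mul_self sum_twist)

/-! ### The type-O partner is impossible -/

/-- **No type-O partner for a rigid level-5 side** (module docstring, steps 2–3): rigid bookkeeping on the budget
`Σ_P (e₅² − 1) + E_off ≤ 1535`, `L₅ ≠ ∅`, and a partner with `W_f = 16u_f`, every `u_f` odd, `#{u_f ≡ ±1 (8)} ≥ 512` ⇒ `False`. [this work] -/
theorem tzv_not_typeO_partner (f g : (Fin (6 + 6) → Bool) → Bool) (hf : IsDegLeFun 3 f) (hg : IsDegLeFun 3 g)
    (u' : (Fin (6 + 6) → Bool) → ℤ) (hu' : ∀ x, W (fun y => signOf (g y)) x = (2 : ℝ) ^ 5 * (u' x : ℝ))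
    (V : Finset (Fin (6 + 6) → Bool)) (x₀ : Fin (6 + 6) → Bool) (h0 : zeroVec ∈ V) (hadd : ∀ a ∈ V, ∀ b ∈ V, bxor a b ∈ V)
    (hcardV : #V = 2048) (hP : (univ.filter fun x : Fin (6 + 6) → Bool => Odd (u' x)) = V.image (bxor x₀))
    (h4off : ∀ y, ¬ Odd (u' y) → (4 : ℤ) ∣ u' y - 2 * sZ (f y))
    (hoff : ∑ y ∈ univ.filter (fun y : Fin (6 + 6) → Bool => ¬ Odd (u' y)), (u' y - 2 * sZ (f y)) ^ 2 ≤ 2047)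
    (hb : (Fin (6 + 6) → Bool) → Bool) (hhb : ∀ z, hb z = decide ((u' z - 2 * sZ (f z)) % 4 = 3))
    (htot : ∑ x ∈ univ.filter (fun x : Fin (6 + 6) → Bool => Odd (u' x)), ((u' x - 2 * sZ (f x)) ^ 2 - 1) +
      ∑ y ∈ univ.filter (fun y : Fin (6 + 6) → Bool => ¬ Odd (u' y)), (u' y - 2 * sZ (f y)) ^ 2 ≤ 1535)
    (hL : ∃ x, Odd (u' x) ∧ ¬ (8 : ℤ) ∣ u' x - 2 * sZ (f x) - sZ (hb x))
    (uf : (Fin (6 + 6) → Bool) → ℤ) (huf : ∀ y, W (fun x => signOf (f x)) y = (2 : ℝ) ^ 4 * (uf y : ℝ)) (hfall : ∀ y, Odd (uf y))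
    (hEf : 512 ≤ #(univ.filter fun y : Fin (6 + 6) → Bool => uf y % 8 = 1 ∨ uf y % 8 = 7)) : False := by
  classical
  have hEnn : (0 : ℤ) ≤ ∑ y ∈ univ.filter (fun y : Fin (6 + 6) → Bool => ¬ Odd (u' y)), (u' y - 2 * sZ (f y)) ^ 2 :=
    sum_nonneg fun _ _ => sq_nonneg _
  have hbud : ∑ x ∈ (univ.filter fun x : Fin (6 + 6) → Bool => Odd (u' x)), ((u' x - 2 * sZ (f x)) ^ 2 - 1) ≤ 1535 := by linarith
  have h128 := tzq_L5_card f g hf hg u' hu' V x₀ h0 hadd hcardV hP h4off hoff hb hhb hbud hL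
  obtain ⟨hRcard, hLcos⟩ := tzt_R_struct f g hf hg u' hu' V x₀ h0 hadd hcardV hP h4off hoff hb hhb hbud hL
  have hq : (1984 : ℤ) ≤ ∑ x, (u' x - 2 * sZ (f x) - (fun x : Fin (6 + 6) → Bool => if Odd (u' x) then (if ¬ (8 : ℤ) ∣ u' x - 2 * sZ (f x) - sZ (hb x) then -3 * sZ (hb x) else sZ (hb x)) else 0) x) ^ 2 := tzv_q_lower f g hf hg u' hu' V x₀ h0 hadd hcardV hP h4off hoff hb hhb hbud hL uf huf hfall hEf
  have h32 := tzv_SR_count f g hf hg u' hu' V x₀ h0 hadd hcardV hP h4off hoff hb hhb hbud hL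
  have hSRv := tzt_SR_val f g hf hg u' hu' V x₀ h0 hadd hcardV hP h4off hoff hb hhb hbud hL
  have hShat := tzt_Shat_val f g hf hg u' hu' V x₀ h0 hadd hcardV hP h4off hoff hb hhb hbud hL
  obtain ⟨t₀, ht₀, ht₀L⟩ := hL
  set S := (fun x : Fin (6 + 6) → Bool => if Odd (u' x) then (if ¬ (8 : ℤ) ∣ u' x - 2 * sZ (f x) - sZ (hb x) then -3 * sZ (hb x) else sZ (hb x)) else 0) with hSdef
  set e : (Fin (6 + 6) → Bool) → ℤ := fun x => u' x - 2 * sZ (f x) with hedef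
  set R := (V.filter fun r => ∀ v ∈ V, (hb x₀ ^^ hb (bxor x₀ r) ^^ hb (bxor x₀ v) ^^ hb (bxor (bxor x₀ r) v)) = false) with hRdef
  set Lset := (univ.filter fun z : Fin (6 + 6) → Bool => Odd (u' z) ∧ ¬ (8 : ℤ) ∣ u' z - 2 * sZ (f z) - sZ (hb z)) with hLdef
  set A := univ.filter (fun x : Fin (6 + 6) → Bool => Odd (u' x) ∧ (8 : ℤ) ∣ u' x - 2 * sZ (f x) - sZ (hb x)) with hAdef
  set O := univ.filter (fun x : Fin (6 + 6) → Bool => ¬ Odd (u' x)) with hOdef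
  have hq' : (1984 : ℤ) ≤ ∑ x, (e x - S x) ^ 2 := hq
  have htot' : ∑ x ∈ (univ.filter fun x : Fin (6 + 6) → Bool => Odd (u' x)), (e x ^ 2 - 1) + ∑ y ∈ O, e y ^ 2 ≤ 1535 := htot
  -- three-way split of sums
  have hsplit : ∀ {M : Type} [AddCommMonoid M] (F : (Fin (6 + 6) → Bool) → M),
      ∑ x, F x = ∑ x ∈ A, F x + ∑ x ∈ Lset, F x + ∑ x ∈ O, F x := by
    intro M _ F
    rw [← sum_filter_add_sum_filter_not univ (fun x : Fin (6 + 6) → Bool => Odd (u' x)) F,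
      ← sum_filter_add_sum_filter_not (univ.filter fun x : Fin (6 + 6) → Bool => Odd (u' x))
        (fun x : Fin (6 + 6) → Bool => (8 : ℤ) ∣ u' x - 2 * sZ (f x) - sZ (hb x)) F,
      filter_filter, filter_filter]
  have hPsplit : ∀ (F : (Fin (6 + 6) → Bool) → ℤ), ∑ x ∈ (univ.filter fun x : Fin (6 + 6) → Bool => Odd (u' x)), F x = ∑ x ∈ A, F x + ∑ x ∈ Lset, F x := by
    intro F
    rw [← sum_filter_add_sum_filter_not (univ.filter fun x : Fin (6 + 6) → Bool => Odd (u' x))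
        (fun x : Fin (6 + 6) → Bool => (8 : ℤ) ∣ u' x - 2 * sZ (f x) - sZ (hb x)) F,
      filter_filter, filter_filter]
  -- pointwise facts
  have hσ : ∀ x, sZ (hb x) = 1 ∨ sZ (hb x) = -1 := fun x => tp_sZ_cases _
  have h4 : ∀ x, Odd (u' x) → (4 : ℤ) ∣ e x - sZ (hb x) := fun x hx => by
    have := tzl5_mod4 f u' hx; rw [hhb]; exact this
  have hmemA : ∀ x, x ∈ A ↔ Odd (u' x) ∧ (8 : ℤ) ∣ e x - sZ (hb x) := fun x => by simp [hAdef, e]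
  have hmemL : ∀ x, x ∈ Lset ↔ Odd (u' x) ∧ ¬ (8 : ℤ) ∣ e x - sZ (hb x) := fun x => by simp [hLdef, e]
  have hmemO : ∀ x, x ∈ O ↔ ¬ Odd (u' x) := fun x => by simp [hOdef]
  have hSA : ∀ x ∈ A, S x = sZ (hb x) := fun x hx => by
    obtain ⟨h1, h2⟩ := (hmemA x).1 hx
    show (if Odd (u' x) then (if ¬ (8 : ℤ) ∣ u' x - 2 * sZ (f x) - sZ (hb x) then -3 * sZ (hb x) else sZ (hb x)) else 0) = sZ (hb x)
    rw [if_pos h1, if_neg (not_not.2 h2)]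
  have hSL : ∀ x ∈ Lset, S x = -3 * sZ (hb x) := fun x hx => by
    obtain ⟨h1, h2⟩ := (hmemL x).1 hx
    show (if Odd (u' x) then (if ¬ (8 : ℤ) ∣ u' x - 2 * sZ (f x) - sZ (hb x) then -3 * sZ (hb x) else sZ (hb x)) else 0) = -3 * sZ (hb x)
    rw [if_pos h1, if_pos h2]
  have hSO : ∀ x ∈ O, S x = 0 := fun x hx => by
    show (if Odd (u' x) then (if ¬ (8 : ℤ) ∣ u' x - 2 * sZ (f x) - sZ (hb x) then -3 * sZ (hb x) else sZ (hb x)) else 0) = 0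
    rw [if_neg ((hmemO x).1 hx)]
  have hqA : ∀ x ∈ A, 3 * (e x - S x) ^ 2 ≤ 4 * (e x ^ 2 - 1) ∧ (64 : ℤ) ∣ (e x - S x) ^ 2 ∧ 0 ≤ e x ^ 2 - 1 := by
    intro x hx
    obtain ⟨h1, h8⟩ := (hmemA x).1 hx
    rw [hSA x hx]
    refine ⟨tzc_pw_three (hσ x) h8, ?_, ?_⟩
    · obtain ⟨m, hm⟩ := h8; exact ⟨m ^ 2, by rw [hm]; ring⟩
    · have h9 : (1 : ℤ) ≤ (u' x - 2 * sZ (f x)) ^ 2 := by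
        have ho := Int.odd_iff.1 (Int.odd_sub.2 (iff_of_true h1 ⟨sZ (f x), two_mul _⟩))
        have : u' x - 2 * sZ (f x) ≤ -1 ∨ 1 ≤ u' x - 2 * sZ (f x) := by omega
        rcases this with h | h <;> nlinarith
      simp only [e]; linarith
  have hqL : ∀ x ∈ Lset, (e x - S x) ^ 2 ≤ 4 * (e x ^ 2 - 9) ∧ (64 : ℤ) ∣ (e x - S x) ^ 2 ∧ 0 ≤ e x ^ 2 - 9 ∧
      (8 : ℤ) ∣ sZ (hb x) * e x + 3 := by
    intro x hx
    obtain ⟨h1, h8⟩ := (hmemL x).1 hx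
    have h8' : (8 : ℤ) ∣ e x + 3 * sZ (hb x) := tzu_dvd_L (hσ x) (h4 x h1) h8
    rw [hSL x hx]
    have ee : e x - -3 * sZ (hb x) = e x + 3 * sZ (hb x) := by ring
    rw [ee]
    refine ⟨tzu_pw_L (hσ x) h8', ?_, ?_, ?_⟩
    · obtain ⟨m, hm⟩ := h8'; exact ⟨m ^ 2, by rw [hm]; ring⟩
    · have h9 := tzr_cost f u' hb hhb h1 h8; simp only [e]; linarith
    · obtain ⟨m, hm⟩ := h8'
      rcases hσ x with h | h
      · exact ⟨m, by rw [h] at hm ⊢; linarith⟩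
      · exact ⟨-m, by rw [h] at hm ⊢; linarith⟩
  have hqO : ∀ x ∈ O, (e x - S x) ^ 2 = e x ^ 2 ∧ (16 : ℤ) ∣ e x ^ 2 := by
    intro x hx
    rw [hSO x hx, sub_zero]
    obtain ⟨m, hm⟩ := h4off x ((hmemO x).1 hx)
    exact ⟨rfl, ⟨m ^ 2, by simp only [e]; rw [hm]; ring⟩⟩
  -- the sums
  set QA := ∑ x ∈ A, (e x - S x) ^ 2 with hQA
  set QL := ∑ x ∈ Lset, (e x - S x) ^ 2 with hQL
  set EO := ∑ x ∈ O, (e x - S x) ^ 2 with hEO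
  set CA := ∑ x ∈ A, (e x ^ 2 - 1) with hCA
  set CL := ∑ x ∈ Lset, (e x ^ 2 - 9) with hCL
  have hqsum : (∑ x, (e x - S x) ^ 2 : ℤ) = QA + QL + EO := hsplit _
  have h3QA : 3 * QA ≤ 4 * CA := by rw [hQA, hCA, mul_sum, mul_sum]; exact sum_le_sum fun x hx => (hqA x hx).1
  have hQL4 : QL ≤ 4 * CL := by rw [hQL, hCL, mul_sum]; exact sum_le_sum fun x hx => (hqL x hx).1
  have h64A : (64 : ℤ) ∣ QA := dvd_sum fun x hx => (hqA x hx).2.1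
  have h64L : (64 : ℤ) ∣ QL := dvd_sum fun x hx => (hqL x hx).2.1
  have hEOe : EO = ∑ x ∈ O, e x ^ 2 := sum_congr rfl fun x hx => (hqO x hx).1
  have h16 : (16 : ℤ) ∣ EO := by rw [hEOe]; exact dvd_sum fun x hx => (hqO x hx).2
  have hQAnn : 0 ≤ QA := sum_nonneg fun _ _ => sq_nonneg _
  have hQLnn : 0 ≤ QL := sum_nonneg fun _ _ => sq_nonneg _
  have hEOnn : 0 ≤ EO := sum_nonneg fun _ _ => sq_nonneg _
  have hCAnn : 0 ≤ CA := sum_nonneg fun x hx => (hqA x hx).2.2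
  have hCLnn : 0 ≤ CL := sum_nonneg fun x hx => (hqL x hx).2.2.1
  -- budget: `CA + CL + EO ≤ 511`
  have hbudget : CA + CL + EO ≤ 511 := by
    have hLs : ∑ x ∈ Lset, (e x ^ 2 - 1) = CL + 1024 := by
      have : ∑ x ∈ Lset, (e x ^ 2 - 1) = ∑ x ∈ Lset, (e x ^ 2 - 9) + ∑ x ∈ Lset, (8 : ℤ) := by
        rw [← sum_add_distrib]; exact sum_congr rfl fun x _ => by ring
      rw [this, sum_const, h128, hCL]; norm_num
    have hPs : ∑ x ∈ (univ.filter fun x : Fin (6 + 6) → Bool => Odd (u' x)), (e x ^ 2 - 1) = CA + (CL + 1024) := by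
      rw [hPsplit, hLs, hCA]
    have ht := htot'
    rw [hPs, ← hEOe] at ht
    linarith
  -- the squeeze
  rw [hqsum] at hq'
  obtain ⟨a, ha⟩ := h64A
  obtain ⟨b, hb'⟩ := h64L
  obtain ⟨c, hc⟩ := h16
  have hkey : QA = 0 ∧ EO = 0 ∧ QL = 1984 ∧ 496 ≤ CL ∧ CL ≤ 511 := by omega
  obtain ⟨hQA0, hEO0, hQL1984, hCL496, hCL511⟩ := hkey
  -- `e = σ` on `A`, `e = 0` off `P`
  have heA : ∀ x ∈ A, e x - S x = 0 := by
    have h := (sum_eq_zero_iff_of_nonneg (fun x (_ : x ∈ A) => sq_nonneg (e x - S x))).1 hQA0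
    intro x hx; exact pow_eq_zero_iff (n := 2) (by norm_num) |>.1 (h x hx)
  have heO : ∀ x ∈ O, e x - S x = 0 := by
    have h := (sum_eq_zero_iff_of_nonneg (fun x (_ : x ∈ O) => sq_nonneg (e x - S x))).1 hEO0
    intro x hx; exact pow_eq_zero_iff (n := 2) (by norm_num) |>.1 (h x hx)
  -- `Σ_L σe = −136`
  have hσe : ∑ x ∈ Lset, (sZ (hb x) * e x + 3) = 248 := by
    have hexp : QL = CL + 6 * ∑ x ∈ Lset, (sZ (hb x) * e x + 3) := by
      rw [hQL, hCL, mul_sum, ← sum_add_distrib]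
      refine sum_congr rfl fun x hx => ?_
      rw [hSL x hx]
      rcases hσ x with h | h <;> rw [h] <;> ring
    have h8 : (8 : ℤ) ∣ ∑ x ∈ Lset, (sZ (hb x) * e x + 3) := dvd_sum fun x hx => (hqL x hx).2.2.2
    obtain ⟨j, hj⟩ := h8
    rw [hj] at hexp ⊢
    omega
  -- a frequency with `S_R = 128`; there every character on `R` is `+1`
  obtain ⟨ys, hys⟩ : (univ.filter fun y : Fin (6 + 6) → Bool => ∑ t ∈ R, signOf (hb x₀ ^^ hb (bxor x₀ t)) * twist t y ≠ 0).Nonempty :=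
    card_pos.1 (by rw [h32]; norm_num)
  have hys' := (mem_filter.1 hys).2
  have hSR128 : ∑ t ∈ R, signOf (hb x₀ ^^ hb (bxor x₀ t)) * twist t ys = 128 := (hSRv ys).resolve_left hys'
  have hall1 : ∀ t ∈ R, signOf (hb x₀ ^^ hb (bxor x₀ t)) * twist t ys = 1 := by
    have hle : ∀ t ∈ R, signOf (hb x₀ ^^ hb (bxor x₀ t)) * twist t ys ≤ 1 := by
      intro t _
      have h1 : signOf (hb x₀ ^^ hb (bxor x₀ t)) = 1 ∨ signOf (hb x₀ ^^ hb (bxor x₀ t)) = -1 := by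
        cases (hb x₀ ^^ hb (bxor x₀ t)) <;> simp [signOf]
      rcases h1 with h | h <;> rcases twist_eq_one_or t ys with h' | h' <;> rw [h, h'] <;> norm_num
    have hsum1 : ∑ t ∈ R, (1 - signOf (hb x₀ ^^ hb (bxor x₀ t)) * twist t ys) = 0 := by
      rw [sum_sub_distrib, sum_const, hRcard, hSR128]; norm_num
    have h := (sum_eq_zero_iff_of_nonneg (fun t ht => sub_nonneg.2 (hle t ht))).1 hsum1
    intro t ht; linarith [h t ht]
  -- on `L₅ = t₀ ⊕ R` every character value is `κ·σ`
  have hsxor : ∀ a b : Bool, signOf (a ^^ b) = signOf a * signOf b := fun a b => by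
    cases a <;> cases b <;> simp [signOf]
  set κ : ℝ := signOf (hb t₀) * twist t₀ ys with hκ
  have hκv : κ = 1 ∨ κ = -1 := by
    have h1 : signOf (hb t₀) = 1 ∨ signOf (hb t₀) = -1 := by cases hb t₀ <;> simp [signOf]
    rcases h1 with h | h <;> rcases twist_eq_one_or t₀ ys with h' | h' <;> simp only [κ, h, h'] <;> norm_num
  have htwL : ∀ x ∈ Lset, twist x ys = κ * signOf (hb x) := by
    intro x hx
    have hx' : x ∈ R.image (bxor t₀) := by rw [← hLcos t₀ ht₀ ht₀L]; exact hx
    obtain ⟨r, hr, rfl⟩ := mem_image.1 hx'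
    have hc := hall1 r hr
    have hcsq : signOf (hb x₀ ^^ hb (bxor x₀ r)) * signOf (hb x₀ ^^ hb (bxor x₀ r)) = 1 := by
      cases (hb x₀ ^^ hb (bxor x₀ r)) <;> simp [signOf]
    have htw : twist r ys = signOf (hb x₀ ^^ hb (bxor x₀ r)) := by
      calc twist r ys = signOf (hb x₀ ^^ hb (bxor x₀ r)) * (signOf (hb x₀ ^^ hb (bxor x₀ r)) * twist r ys) := by
            rw [← mul_assoc, hcsq, one_mul]
        _ = signOf (hb x₀ ^^ hb (bxor x₀ r)) := by rw [hc, mul_one]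
    have hs2 : signOf (hb t₀) * signOf (hb t₀) = 1 := by cases hb t₀ <;> simp [signOf]
    rw [twist_bxor_left, tzt_equivariant u' V x₀ hP hb hr ht₀, hsxor (hb t₀) (hb x₀ ^^ hb (bxor x₀ r)), htw, hκ]
    have hre : signOf (hb t₀) * twist t₀ ys * (signOf (hb t₀) * signOf (hb x₀ ^^ hb (bxor x₀ r))) =
        (signOf (hb t₀) * signOf (hb t₀)) * (twist t₀ ys * signOf (hb x₀ ^^ hb (bxor x₀ r))) := by ring
    rw [hre, hs2, one_mul]
  -- evaluate `W(e − S)(ys)` in two ways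
  have hWval := tzu_W_eq f g u' hu' hb ys
  obtain ⟨k, -, hk⟩ := hShat ys
  have hLHS : W (fun a => (((e a - S a : ℤ)) : ℝ)) ys = 248 * κ := by
    show ∑ a, (((e a - S a : ℤ)) : ℝ) * twist a ys = 248 * κ
    rw [hsplit (fun a => (((e a - S a : ℤ)) : ℝ) * twist a ys)]
    have hA0 : ∑ a ∈ A, (((e a - S a : ℤ)) : ℝ) * twist a ys = 0 :=
      sum_eq_zero fun a ha => by rw [heA a ha]; simp
    have hO0 : ∑ a ∈ O, (((e a - S a : ℤ)) : ℝ) * twist a ys = 0 :=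
      sum_eq_zero fun a ha => by rw [heO a ha]; simp
    have hLv : ∑ a ∈ Lset, (((e a - S a : ℤ)) : ℝ) * twist a ys = κ * ∑ a ∈ Lset, (((sZ (hb a) * e a + 3 : ℤ)) : ℝ) := by
      rw [mul_sum]
      refine sum_congr rfl fun a ha => ?_
      rw [hSL a ha, htwL a ha, ← tp_sZ_cast (hb a)]
      push_cast
      rcases hσ a with h | h <;> rw [h] <;> push_cast <;> ring
    rw [hA0, hO0, hLv, zero_add, add_zero]
    have hI : (∑ a ∈ Lset, (((sZ (hb a) * e a + 3 : ℤ)) : ℝ)) = 248 := by exact_mod_cast hσe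
    rw [hI]; ring
  rw [hWval, hk, huf ys, ← tp_sZ_cast (g ys)] at hLHS
  have hsg := tp_sZ_cases (g ys)
  have hou := Int.odd_iff.1 (hfall ys)
  rcases hκv with hκ1 | hκ1
  · rw [hκ1] at hLHS
    have hZ : (((128 * sZ (g ys) - 32 * uf ys - 512 * k : ℤ)) : ℝ) = 248 := by push_cast; linarith
    have hZ' : 128 * sZ (g ys) - 32 * uf ys - 512 * k = 248 := by exact_mod_cast hZ
    omega
  · rw [hκ1] at hLHS
    have hZ : (((128 * sZ (g ys) - 32 * uf ys - 512 * k : ℤ)) : ℝ) = -248 := by push_cast; linarith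
    have hZ' : 128 * sZ (g ys) - 32 * uf ys - 512 * k = -248 := by exact_mod_cast hZ
    omega

/-! ### Packaging on the open window -/

/-- **A rigid level-5 side with `4 ∣ e₅` off its odd hyperplane is impossible on the open window.**  Cubic `f, g` on 12 bits, `W_g = 32u'`
with some `u'` odd, `57/64 < Φ(f,g) < 1`, `4 ∣ e₅` off the odd set, some point of the odd set with `e₅ ≢ σ₅ (mod 8)` ⇒ `False`.
Finite-slice statement, NOT summit progress. [this work] -/
theorem tzv_rigid_window_false (f g : (Fin (6 + 6) → Bool) → Bool) (hf : IsDegLeFun 3 f) (hg : IsDegLeFun 3 g)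
    (u' : (Fin (6 + 6) → Bool) → ℤ) (hu' : ∀ x, W (fun y => signOf (g y)) x = (2 : ℝ) ^ 5 * (u' x : ℝ)) (hodd : ∃ x, Odd (u' x))
    (hlo : (57 / 64 : ℝ) < forrelation f g) (hhi : forrelation f g < 1)
    (h4off : ∀ y, ¬ Odd (u' y) → (4 : ℤ) ∣ u' y - 2 * sZ (f y))
    (hL : ∃ x, Odd (u' x) ∧ ¬ (8 : ℤ) ∣ u' x - 2 * sZ (f x) - sZ (decide ((u' x - 2 * sZ (f x)) % 4 = 3))) : False := by
  classical
  set hb : (Fin (6 + 6) → Bool) → Bool := fun z => decide ((u' z - 2 * sZ (f z)) % 4 = 3) with hbdef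
  have hhb : ∀ z, hb z = decide ((u' z - 2 * sZ (f z)) % 4 = 3) := fun z => rfl
  have hL' : ∃ x, Odd (u' x) ∧ ¬ (8 : ℤ) ∣ u' x - 2 * sZ (f x) - sZ (hb x) := hL
  obtain ⟨u₄, hu₄, hall⟩ := tzu_rigid_partner_typeO f g hf hg u' hu' hodd hlo hhi h4off hb hhb hL'
  obtain ⟨-, hEf⟩ := tzp_typeO_struct f hf u₄ hu₄ ⟨zeroVec, hall zeroVec⟩
  obtain ⟨V, x₀, h0, hadd, hcardV, hP, -, -, -, -, h511, htot⟩ :=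
    tzr_window_rigid f g hf hg u' hu' hodd hlo h4off hb hhb hL'
  have hoff : ∑ y ∈ univ.filter (fun y : Fin (6 + 6) → Bool => ¬ Odd (u' y)), (u' y - 2 * sZ (f y)) ^ 2 ≤ 2047 := by linarith
  exact tzv_not_typeO_partner f g hf hg u' hu' V x₀ h0 hadd hcardV hP h4off hoff hb hhb htot hL' u₄ hu₄ hall hEf

/-- **A level-5 side on the open window is in case α** (packaging with gen 27's `tzl5_window_structure`): cubic `f, g` on 12 bits,
`W_g = 32u'` with some `u'` odd, `57/64 < Φ(f,g) < 1` ⇒ some point with `u'` even has `4 ∤ u' − 2(−1)^f` (then `A₂` is an 8-flat of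
`256` points, …TwelveLevelFiveAlphaFlat, and the off-hyperplane energy is `≥ 1024`).  Finite-slice statement, NOT summit progress. [this work] -/
theorem tzv_levelFive_window_alpha (f g : (Fin (6 + 6) → Bool) → Bool) (hf : IsDegLeFun 3 f) (hg : IsDegLeFun 3 g)
    (u' : (Fin (6 + 6) → Bool) → ℤ) (hu' : ∀ x, W (fun y => signOf (g y)) x = (2 : ℝ) ^ 5 * (u' x : ℝ)) (hodd : ∃ x, Odd (u' x))
    (hlo : (57 / 64 : ℝ) < forrelation f g) (hhi : forrelation f g < 1) :
    ∃ y, ¬ Odd (u' y) ∧ ¬ (4 : ℤ) ∣ u' y - 2 * sZ (f y) := by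
  by_contra hno
  push Not at hno
  rcases tzl5_window_structure f g hf hg u' hu' hodd hlo hhi with ⟨y, hy, hy4⟩ | hrig
  · exact hy4 (hno y hy)
  · exact tzv_rigid_window_false f g hf hg u' hu' hodd hlo hhi hno hrig

end Summit.QuantumAdvantage.QuantumAdvantage.Theorems.CubicForrelation.NearExactIsExact

end
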